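import Literature.NumberTheory.PAdicHodge.AxSenTate
import Mathlib.RingTheory.Polynomial.GaussNorm
import Mathlib.LinearAlgebra.Lagrange
import HarnessLib

/-!
# Tate's almost étale lemma — ultrametric polynomial toolkit

Elementary estimates over an ultrametric normed field `L`, used by `TateAlmostEtaleGauge` /
`TateAlmostEtale` (the different-free proof of Tate 1967 §3.2 Prop. 9 via Serre IV §1 Prop. 3):

* `norm_eval_le_of_coeff_le` : `‖R(z)‖ ≤ B` when all `‖R_j‖ ≤ B` and `‖z‖ ≤ 1`;
* `norm_eval_sub_eval_le` : `‖R(a) − R(b)‖ ≤ ‖a − b‖` for `R` with integral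
  coefficients and `a, b` integral — the valuation form of Serre's divisibility `sx − x ∣ sa − a`
  (IV §1 Lemma 1);
* `norm_coeff_nodal_le_one` : the symmetric functions of integral elements are integral;
* `norm_coeff_le_one_of_monic_mul` : Gauss's lemma in norm form (cofactor of a monic polynomial
  inside an integral polynomial is integral), from Mathlib's multiplicativity of the Gauss norm;
* `map_nodal` : `(nodal s v).map φ = nodal s (φ ∘ v)`.

References: J.-P. Serre, *Local Fields*, Ch. IV §1 [SerreLocalFields1979].
-/

noncomputable section

open scoped Classical
open Polynomial Finset

namespace Literature.NumberTheory.PAdicHodge.TateAlmostEtale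

/-! ## §1 Ultrametric polynomial toolkit -/

section Toolkit

variable {L : Type*} [NormedField L] [IsUltrametricDist L]

/-- `‖R(z)‖ ≤ B` if all coefficients of `R` have norm `≤ B` and `‖z‖ ≤ 1` (ultrametric inequality).
[cite: SerreLocalFields1979, Ch. IV §1 (valuation estimates behind Prop. 2–3)] -/
theorem norm_eval_le_of_coeff_le (R : L[X]) {B : ℝ} (hB : 0 ≤ B) (hR : ∀ j, ‖R.coeff j‖ ≤ B)
    {z : L} (hz : ‖z‖ ≤ 1) : ‖R.eval z‖ ≤ B := by
  rw [eval_eq_sum, Polynomial.sum]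
  refine IsUltrametricDist.norm_sum_le_of_forall_le_of_nonneg hB fun j _ => ?_
  rw [norm_mul, norm_pow]
  exact (mul_le_mul (hR j) (pow_le_one₀ (norm_nonneg z) hz) (pow_nonneg (norm_nonneg z) _) hB).trans
    (mul_one B).le

/-- `‖a ^ n − b ^ n‖ ≤ ‖a − b‖` for `‖a‖, ‖b‖ ≤ 1` (`a^n − b^n = (a − b) Σ a^i b^{n−1−i}`); a private
copy of `TateAlmostEtale.norm_pow_sub_pow_le` of `CyclotomicTowerPthPowers` (kept local so that this
toolkit does not import the completed-closure files). [folklore] -/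
private theorem norm_pow_sub_pow_le' {a b : L} (ha : ‖a‖ ≤ 1) (hb : ‖b‖ ≤ 1) (n : ℕ) :
    ‖a ^ n - b ^ n‖ ≤ ‖a - b‖ := by
  rw [← geom_sum₂_mul, norm_mul]
  refine (mul_le_mul_of_nonneg_right ?_ (norm_nonneg _)).trans (one_mul _).le
  refine IsUltrametricDist.norm_sum_le_of_forall_le_of_nonneg zero_le_one fun i _ => ?_
  rw [norm_mul, norm_pow, norm_pow]
  exact mul_le_one₀ (pow_le_one₀ (norm_nonneg a) ha) (pow_nonneg (norm_nonneg b) _)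
    (pow_le_one₀ (norm_nonneg b) hb)

/-- `‖R(a) − R(b)‖ ≤ ‖a − b‖` for a polynomial `R` with integral coefficients and `‖a‖, ‖b‖ ≤ 1`:
the valuation form of `(a − b) ∣ R(a) − R(b)` used throughout Serre IV §1.
[cite: SerreLocalFields1979, Ch. IV §1 Lemma 1 / Prop. 2 (the divisibility `sx − x ∣ sa − a`)] -/
theorem norm_eval_sub_eval_le (R : L[X]) (hR : ∀ j, ‖R.coeff j‖ ≤ 1) {a b : L} (ha : ‖a‖ ≤ 1)
    (hb : ‖b‖ ≤ 1) : ‖R.eval a - R.eval b‖ ≤ ‖a - b‖ := by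
  rw [eval_eq_sum, eval_eq_sum, Polynomial.sum, Polynomial.sum, ← Finset.sum_sub_distrib]
  refine IsUltrametricDist.norm_sum_le_of_forall_le_of_nonneg (norm_nonneg _) fun j _ => ?_
  rw [← mul_sub, norm_mul]
  exact (mul_le_mul (hR j) (norm_pow_sub_pow_le' ha hb j) (norm_nonneg _) zero_le_one).trans
    (one_mul _).le

/-- The coefficients of `∏_{i} (X − aᵢ)` (a `nodal` polynomial) with `‖aᵢ‖ ≤ 1` have norm `≤ 1`.
[cite: SerreLocalFields1979, Ch. IV §1 (integrality of the symmetric functions of conjugates)] -/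
theorem norm_coeff_nodal_le_one {ι : Type*} (s : Finset ι) (v : ι → L) (hv : ∀ i ∈ s, ‖v i‖ ≤ 1)
    (j : ℕ) : ‖(Lagrange.nodal s v).coeff j‖ ≤ 1 := by
  rw [Lagrange.nodal, Finset.prod_eq_multiset_prod,
    show (Multiset.map (fun i => X - C (v i)) s.val) =
      Multiset.map (fun δ => X - C δ) (s.val.map v) by rw [Multiset.map_map]; rfl]
  have h := norm_coeff_prod_X_sub_C_le (s.val.map v) zero_le_one
    (fun δ hδ => by obtain ⟨i, hi, rfl⟩ := Multiset.mem_map.mp hδ; exact hv i hi) j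
  rwa [one_pow] at h

/-- **Gauss's lemma in norm form**: if `f` is monic and `f * q` has integral coefficients, then
`q` has integral coefficients (multiplicativity of the Gauss norm,
Mathlib `Polynomial.gaussNorm_mul`). [cite: SerreLocalFields1979, Ch. IV §1 Prop. 3 (proof: the cofactor `g − y = f·h` is integral)] -/
theorem norm_coeff_le_one_of_monic_mul {f q : L[X]} (hf : f.Monic)
    (hfq : ∀ j, ‖(f * q).coeff j‖ ≤ 1) (j : ℕ) : ‖q.coeff j‖ ≤ 1 := by
  let v : AbsoluteValue L ℝ := NormedField.toAbsoluteValue L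
  have hna : IsNonarchimedean v := fun a b => IsUltrametricDist.norm_add_le_max a b
  have hmul := Polynomial.gaussNorm_mul hna one_pos f q
  -- `gaussNorm f ≥ 1` (leading coefficient `1`), `gaussNorm (f*q) ≤ 1`
  have hf_ge : 1 ≤ f.gaussNorm v 1 := by
    have := f.le_gaussNorm v zero_le_one f.natDegree
    rwa [one_pow, mul_one, show v (f.coeff f.natDegree) = 1 by
      rw [Polynomial.Monic.coeff_natDegree hf]; exact v.map_one] at this
  have hle : ∀ (r : L[X]), (∀ j, ‖r.coeff j‖ ≤ 1) → r.gaussNorm v 1 ≤ 1 := by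
    intro r hr
    obtain ⟨i, hi⟩ := r.exists_eq_gaussNorm v 1
    rw [hi, one_pow, mul_one]
    exact hr i
  have hq0 : 0 ≤ q.gaussNorm v 1 := q.gaussNorm_nonneg v zero_le_one
  have hq1 : q.gaussNorm v 1 ≤ 1 := by
    by_contra h
    push Not at h
    have : 1 < (f * q).gaussNorm v 1 := by
      rw [hmul]
      calc (1 : ℝ) = 1 * 1 := (mul_one 1).symm
        _ < f.gaussNorm v 1 * q.gaussNorm v 1 :=
            mul_lt_mul' hf_ge h zero_le_one (lt_of_lt_of_le one_pos hf_ge)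
    exact absurd (hle (f * q) hfq) (not_le.mpr this)
  have := q.le_gaussNorm v zero_le_one j
  rw [one_pow, mul_one] at this
  exact this.trans hq1

end Toolkit

/-- A `nodal` polynomial `∏ (X − vᵢ)` is mapped by a ring homomorphism to the nodal polynomial of
the image nodes (applying `σ` to `f = ∏_{τ}(X − τx)`, as in Serre's proof of IV §1 Prop. 3).
[cite: SerreLocalFields1979, Ch. IV §1 Prop. 3 (proof: σ applied to the minimal polynomial)] -/
theorem map_nodal {R S : Type*} [CommRing R] [CommRing S] (φ : R →+* S) {ι : Type*} (s : Finset ι)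
    (v : ι → R) : (Lagrange.nodal s v).map φ = Lagrange.nodal s (φ ∘ v) := by
  rw [Lagrange.nodal_eq, Lagrange.nodal_eq, Polynomial.map_prod]
  refine Finset.prod_congr rfl fun i _ => ?_
  rw [Polynomial.map_sub, map_X, map_C, Function.comp_apply]


end Literature.NumberTheory.PAdicHodge.TateAlmostEtale

end
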